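import Literature.Geometry.Kaehler.ComplexTorusAnalyticIteratedIntersectionCycle
import HarnessLib

/-!
# The class of a general iterated translate intersection:
# `[Y ∩ ⋂_j (D_j − t_j)] = sign(e)^k · [Y] ∧ [D₀] ∧ ⋯ ∧ [D_{k−1}]` for almost every `(t_j) ∈ X^k`

Layer `Literature/Geometry/Kaehler`; lane `lit-hodgefound`, seat p07, programme «INTERSECTION NUMBERS ARE
POINT COUNTS», file 5. Let `X = E/Λ` be a compact complex torus of dimension `g`, `Y ⊆ X` closed analytic
of pure dimension `d = r + k`, `D₀, …, D_{k−1} ⊆ X` closed analytic hypersurfaces, `Z(τ) = Y ∩ ⋂_j (D_j − t_j)`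
(`τ = (t_j) ∈ X^k`). File 4 (`ComplexTorusAnalyticIteratedIntersectionCycle`) shows that for a dense open
full-measure set of `τ` the intersection class `sign(e)^k · [Y] ∧ [D₀] ∧ ⋯ ∧ [D_{k−1}]` is `[Z(τ)] + cl(T_τ)`
with `T_τ` an EFFECTIVE `r`-cycle on `Z(τ)`. Here we show that the excess `T_τ` VANISHES for almost every
`τ` — the general iterated translates meet `Y` with all multiplicities ONE — by COUNTING POINTS: cutting
further by `r` general translates of an auxiliary hypersurface `H`, the number of points of
`Z(τ) ∩ ⋂_i (H − s_i)` computes, for almost every `(τ, s) ∈ X^k × X^r`, both the `H`-degree of the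
intersection class (`ComplexTorusAnalyticHypersurfaceTranslatesPointCount` for `Y` and the `k + r`
hypersurfaces `D_j, H`) and, for almost every `s`, the `H`-degree of `[Z(τ)]` (the same theorem for `Z(τ)`);
so the `H`-degree of the effective `T_τ` is `0`, which forces `T_τ = 0` as soon as `H` is numerically positive
on the `r`-dimensional analytic subsets of `Y`:

> (P) every `r` translates of `H` meet every irreducible `r`-dimensional closed analytic `W ⊆ Y`
> (equivalently `[W] · [H]^r ≠ 0`, `wedge_wedgeFamily_ne_zero_iff_forall_inter_iInter_translate_nonempty`;
> e.g. `H` an ample divisor of an abelian variety).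

This is Lange's "`(V · W)` is the degree of the `0`-cycle `V · t_x^* W`" / Fulton's "the cycles
`φ_g(V) · W` … represent `V · W`" for iterated hypersurface translates, in positive expected dimension
([Lange2023AbelianVarietiesComplex, §4.6.2 Lemma 4.6.4 and p. 235; Fulton1998, Example 11.4.5]); the general
statement — multiplicity one of generic translates for any group variety, Kleiman's transversality theorem
(b) [Kleiman1974Transversality, Thm. 2 (ii); Fulton1998, Appendix B.9.2] — is proved there by generic
smoothness, whereas the counting argument used here needs the positivity hypothesis (P).

Contents (theorems only; no definitions, no named facts):

* §1 `measurePreserving_finAppend` — concatenation `(τ, s) ↦ (τ ++ s)`, `X^k × X^r → X^{k+r}`, preserves the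
  product Haar measures (`MeasurableEquiv.sumPiEquivProdPi`, `MeasurableEquiv.piCongrLeft`); `ae_ae_append_of_ae`
  (Fubini: a.e. in `X^{k+r}` ⟹ a.e. `τ`, a.e. `s`);
* §2 (peeling the last `r` translates; private plumbing) and `wedge_wedgeFamily_append_eq` (the classes of a
  concatenated family: `[Y] ∧ (F₀ ∧ ⋯ ∧ F_{k+r−1}) = ([Y] ∧ D₀ ∧ ⋯ ∧ D_{k−1}) ∧ (H₀ ∧ ⋯ ∧ H_{r−1})`);
* §3 **`ae_smul_wedge_wedgeFamily_eq_setCycleClass`** — THE THEOREM: under (P), for almost every `τ ∈ X^k`,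
  `sign(e)^k · [Y]_e ∧ [D₀]_e ∧ ⋯ ∧ [D_{k−1}]_e = [Z(τ)]_e` (and `Z(τ)` is empty or of pure dimension `r`);
  `exists_smul_wedge_wedgeFamily_eq_setCycleClass` (some `τ`),
  `ae_smul_wedge_wedgeFamily_eq_setCycleClass_of_wedge_wedgePow_ne_zero` ((P) in the cohomological form
  `[W] ∧ [H]^r ≠ 0`); the hypothesis-free case `r = 0` is `ComplexTorusAnalyticHypersurfaceTranslatesPointCount`.

## References

* [Lange2023AbelianVarietiesComplex] H. Lange, *Abelian Varieties over the Complex Numbers*, Springer 2023,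
  §4.6.2 (Lemma 4.6.4, p. 235, proof of Lemma 4.6.9).
* [Fulton1998] W. Fulton, *Intersection Theory*, 2nd ed., Springer 1998, §8.2, Example 11.4.5, §12.2,
  Appendix B.9.2.
* [Kleiman1974Transversality] S. L. Kleiman, *The transversality of a general translate*, Compositio Math. 28
  (1974) 287–297, Thm. 2.
* [Federer1969] H. Federer, *Geometric Measure Theory*, Springer 1969, 2.6.2 (Fubini).
-/

noncomputable section

open scoped Manifold Topology Pointwise
open MeasureTheory Set Function Filter Module
open Literature.LinearAlgebra.Alternating

namespace Literature.Geometry.Kaehler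
namespace ComplexTorus

universe u

variable {ι : Type*} [Fintype ι] [DecidableEq ι] {E : Type u} [NormedAddCommGroup E] [InnerProductSpace ℂ E]
  [FiniteDimensional ℂ E] [MeasurableSpace E] [BorelSpace E] (Φ : (ι → ℝ) ≃L[ℝ] E) {n : ℕ} (e : Fin n ≃ ι)

/-! ### §1 Concatenation `X^k × X^r → X^{k+r}` preserves the product measures; Fubini -/

omit [Fintype ι] [DecidableEq ι] [FiniteDimensional ℂ E] [MeasurableSpace E] [BorelSpace E] in
/-- The concatenation map is the composite of the standard measurable equivalences
`X^k × X^r ≃ X^{k ⊔ r} ≃ X^{k+r}`. [folklore] -/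
private theorem piCongrLeft_sumPiEquivProdPi_symm_eq_append {k r : ℕ}
    (z : (Fin k → ComplexTorus Φ) × (Fin r → ComplexTorus Φ)) :
    MeasurableEquiv.piCongrLeft (fun _ ↦ ComplexTorus Φ) finSumFinEquiv
        ((MeasurableEquiv.sumPiEquivProdPi fun _ : Fin k ⊕ Fin r ↦ ComplexTorus Φ).symm z) =
      Fin.append z.1 z.2 := by
  funext j
  refine Fin.addCases (fun i ↦ ?_) (fun i ↦ ?_) j
  · rw [Fin.append_left, ← finSumFinEquiv_apply_left, MeasurableEquiv.piCongrLeft_apply_apply,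
      MeasurableEquiv.coe_sumPiEquivProdPi_symm, Equiv.sumPiEquivProdPi_symm_apply]
  · rw [Fin.append_right, ← finSumFinEquiv_apply_right, MeasurableEquiv.piCongrLeft_apply_apply,
      MeasurableEquiv.coe_sumPiEquivProdPi_symm, Equiv.sumPiEquivProdPi_symm_apply]

omit [DecidableEq ι] [FiniteDimensional ℂ E] [MeasurableSpace E] [BorelSpace E] in
/-- **Concatenation `(τ, s) ↦ (t₀, …, t_{k−1}, s₀, …, s_{r−1})` preserves the product Haar measures**
`vol_{X^k} ⊗ vol_{X^r} ↦ vol_{X^{k+r}}`. [cite: Federer1969, 2.6.2] -/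
theorem measurePreserving_finAppend (k r : ℕ) :
    MeasurePreserving (fun z : (Fin k → ComplexTorus Φ) × (Fin r → ComplexTorus Φ) ↦ Fin.append z.1 z.2)
      volume volume := by
  have h := (volume_measurePreserving_piCongrLeft (fun _ : Fin (k + r) ↦ ComplexTorus Φ) finSumFinEquiv).comp
    (volume_measurePreserving_sumPiEquivProdPi_symm fun _ : Fin k ⊕ Fin r ↦ ComplexTorus Φ)
  have hf : (fun z : (Fin k → ComplexTorus Φ) × (Fin r → ComplexTorus Φ) ↦ Fin.append z.1 z.2) =
      MeasurableEquiv.piCongrLeft (fun _ ↦ ComplexTorus Φ) finSumFinEquiv ∘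
        (MeasurableEquiv.sumPiEquivProdPi fun _ : Fin k ⊕ Fin r ↦ ComplexTorus Φ).symm :=
    funext fun z ↦ (piCongrLeft_sumPiEquivProdPi_symm_eq_append Φ z).symm
  rw [hf]
  exact h

omit [DecidableEq ι] [FiniteDimensional ℂ E] [MeasurableSpace E] [BorelSpace E] in
/-- **Fubini along the splitting `X^{k+r} = X^k × X^r`**: a property of almost every `u ∈ X^{k+r}` holds, for
almost every `τ ∈ X^k`, for almost every `s ∈ X^r` at `u = (τ, s)`. [cite: Federer1969, 2.6.2] -/
theorem ae_ae_append_of_ae {k r : ℕ} {P : (Fin (k + r) → ComplexTorus Φ) → Prop}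
    (h : ∀ᵐ u ∂(volume : Measure (Fin (k + r) → ComplexTorus Φ)), P u) :
    ∀ᵐ τ ∂(volume : Measure (Fin k → ComplexTorus Φ)), ∀ᵐ s ∂(volume : Measure (Fin r → ComplexTorus Φ)),
      P (Fin.append τ s) := by
  have h1 := (measurePreserving_finAppend Φ k r).quasiMeasurePreserving.ae h
  rw [Measure.volume_eq_prod] at h1
  exact Measure.ae_ae_of_ae_prod h1

/-! ### §2 Concatenated families of hypersurfaces: the intersection and the classes -/

omit [Fintype ι] [DecidableEq ι] [FiniteDimensional ℂ E] [MeasurableSpace E] [BorelSpace E] in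
/-- `Y ∩ ⋂_{j < k+r} (F_j − u_j)` for the concatenated family `F = (D, H…)` and `u = (τ, s)` is
`(Y ∩ ⋂_{j<k} (D_j − τ_j)) ∩ ⋂_{i<r} (H_i − s_i)`. [folklore] -/
private theorem inter_iInter_translate_append {k r : ℕ} (Y : Set (ComplexTorus Φ)) (D : Fin k → Set (ComplexTorus Φ))
    (H : Fin r → Set (ComplexTorus Φ)) (τ : Fin k → ComplexTorus Φ) (s : Fin r → ComplexTorus Φ) :
    Y ∩ ⋂ j, (fun x ↦ x + Fin.append τ s j) ⁻¹' Fin.append D H j =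
      (Y ∩ ⋂ j, (fun x ↦ x + τ j) ⁻¹' D j) ∩ ⋂ i, (fun x ↦ x + s i) ⁻¹' H i := by
  ext x
  simp only [mem_inter_iff, mem_iInter, mem_preimage, Fin.forall_fin_add, Fin.append_left, Fin.append_right,
    and_assoc]

/-- Classes of equal sets are equal. [folklore] -/
private theorem analyticCycleClass_congr_set₉ {k d : ℕ} (h : 2 * d + k = n) {Z Z' : Set (ComplexTorus Φ)}
    (hZZ' : Z = Z') (hZ : HasPureDim 𝓘(ℂ, E) Z d) (hZ' : HasPureDim 𝓘(ℂ, E) Z' d) :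
    analyticCycleClass Φ e h hZ = analyticCycleClass Φ e h hZ' := by
  subst hZZ'
  rfl

omit [DecidableEq ι] [FiniteDimensional ℂ E] [MeasurableSpace E] [BorelSpace E] in
/-- The members of a concatenated family of pure `q`-dimensional sets are pure `q`-dimensional. [folklore] -/
private theorem hasPureDim_append {k r q : ℕ} {D : Fin k → Set (ComplexTorus Φ)} {H : Fin r → Set (ComplexTorus Φ)}
    (hD : ∀ j, HasPureDim 𝓘(ℂ, E) (D j) q) (hH : ∀ i, HasPureDim 𝓘(ℂ, E) (H i) q) (j : Fin (k + r)) :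
    HasPureDim 𝓘(ℂ, E) (Fin.append D H j) q := by
  refine Fin.addCases (motive := fun j ↦ HasPureDim 𝓘(ℂ, E) (Fin.append D H j) q) (fun i ↦ ?_) (fun i ↦ ?_) j
  · rw [Fin.append_left]; exact hD i
  · rw [Fin.append_right]; exact hH i

/-- The classes of a concatenated family are the concatenation of the classes. [folklore] -/
private theorem analyticCycleClass_append_eq {k r q : ℕ} (hq : 2 * q + 2 * 1 = n) {D : Fin k → Set (ComplexTorus Φ)}
    {H : Fin r → Set (ComplexTorus Φ)} (hD : ∀ j, HasPureDim 𝓘(ℂ, E) (D j) q) (hH : ∀ i, HasPureDim 𝓘(ℂ, E) (H i) q)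
    (hDH : ∀ j, HasPureDim 𝓘(ℂ, E) (Fin.append D H j) q) :
    (fun j ↦ analyticCycleClass Φ e hq (hDH j)) =
      Fin.append (fun j ↦ analyticCycleClass Φ e hq (hD j)) (fun i ↦ analyticCycleClass Φ e hq (hH i)) := by
  funext j
  refine Fin.addCases (motive := fun j ↦ analyticCycleClass Φ e hq (hDH j) =
    Fin.append (fun j ↦ analyticCycleClass Φ e hq (hD j)) (fun i ↦ analyticCycleClass Φ e hq (hH i)) j)
    (fun i ↦ ?_) (fun i ↦ ?_) j
  · rw [Fin.append_left (fun j ↦ analyticCycleClass Φ e hq (hD j)) (fun i ↦ analyticCycleClass Φ e hq (hH i)) i]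
    exact analyticCycleClass_congr_set₉ Φ e hq (Fin.append_left D H i) _ _
  · rw [Fin.append_right (fun j ↦ analyticCycleClass Φ e hq (hD j)) (fun i ↦ analyticCycleClass Φ e hq (hH i)) i]
    exact analyticCycleClass_congr_set₉ Φ e hq (Fin.append_right D H i) _ _

/-- **`[Y] ∧ (F₀ ∧ ⋯ ∧ F_{k+r−1}) = (([Y] ∧ (D₀ ∧ ⋯ ∧ D_{k−1})) ∧ (H₀ ∧ ⋯ ∧ H_{r−1}))`** for the concatenated
family of classes (associativity of `∧`, `wedge_wedgeFamily`), with the re-indexings made explicit.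
[cite: Lange2023AbelianVarietiesComplex, §7.3.1] -/
theorem wedge_wedgeFamily_append_eq {k r q p p' : ℕ} (hq : 2 * q + 2 * 1 = n) (hp' : p + k = p')
    (γ : E [⋀^Fin (2 * p)]→L[ℝ] ℂ) {D : Fin k → Set (ComplexTorus Φ)} {H : Fin r → Set (ComplexTorus Φ)}
    (hD : ∀ j, HasPureDim 𝓘(ℂ, E) (D j) q) (hH : ∀ i, HasPureDim 𝓘(ℂ, E) (H i) q)
    (hDH : ∀ j, HasPureDim 𝓘(ℂ, E) (Fin.append D H j) q) (hn : 2 * p' + 2 * r = n) :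
    (((γ.wedge (wedgeFamily k fun j ↦ analyticCycleClass Φ e hq (hD j))).domDomCongr
          (finCongr (by omega : 2 * p + 2 * k = 2 * p'))).wedge
        (wedgeFamily r fun i ↦ analyticCycleClass Φ e hq (hH i))).domDomCongr (finCongr hn) =
      (γ.wedge (wedgeFamily (k + r) fun j ↦ analyticCycleClass Φ e hq (hDH j))).domDomCongr
        (finCongr (by omega : 2 * p + 2 * (k + r) = n)) := by
  rw [analyticCycleClass_append_eq Φ e hq hD hH hDH, domDomCongr_finCongr_wedge, domDomCongr_finCongr_trans,
    ContinuousAlternatingMap.WedgeAssoc_holds ℝ E ℂ γ _ _, domDomCongr_finCongr_trans, wedge_wedgeFamily,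
    wedge_domDomCongr_finCongr, domDomCongr_finCongr_trans]

/-! ### §3 The theorem: the intersection class is the class of a general iterated translate intersection -/

omit [FiniteDimensional ℂ E] [MeasurableSpace E] [BorelSpace E] in
/-- `c • vol = c' • vol ⟹ c = c'`. [folklore] -/
private theorem smul_volumeForm_injective : Function.Injective fun c : ℂ ↦ c • volumeForm Φ e := by
  have hvol : volumeForm Φ e ≠ 0 := fun hv ↦ by
    have h1 := torusIntegral_volumeForm Φ e
    rw [hv, torusIntegral_zero] at h1
    exact zero_ne_one h1
  exact smul_left_injective ℂ hvol

omit [Fintype ι] [FiniteDimensional ℂ E] [MeasurableSpace E] [BorelSpace E] in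
/-- `sign(e)^m ≠ 0` in `ℂ`. [folklore] -/
private theorem pow_orientationSign_ne_zero (m : ℕ) : ((orientationSign Φ e : ℤ) : ℂ) ^ m ≠ 0 :=
  pow_ne_zero _ fun h ↦ by
    have h1 := orientationSign_cast_mul_self Φ e
    rw [h, zero_mul] at h1
    exact zero_ne_one h1

omit [Fintype ι] [FiniteDimensional ℂ E] [MeasurableSpace E] [BorelSpace E] in
/-- `sign(e)^{2m+j} = sign(e)^j`. [folklore] -/
private theorem pow_orientationSign_two_mul_add (m j : ℕ) :
    ((orientationSign Φ e : ℤ) : ℂ) ^ (2 * m + j) = ((orientationSign Φ e : ℤ) : ℂ) ^ j := by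
  rw [pow_add, pow_mul, sq, orientationSign_cast_mul_self, one_pow, one_mul]

omit [DecidableEq ι] [FiniteDimensional ℂ E] [MeasurableSpace E] [BorelSpace E] in
/-- A holomorphic chain with support contained in `∅` is `0`. [folklore] -/
private theorem eq_zero_of_support_subset_empty {r : ℕ} (T : HolomorphicChain 𝓘(ℂ, E) (ComplexTorus Φ) r)
    (h : T.support ⊆ ∅) : T = 0 := by
  ext W
  rw [HolomorphicChain.mult_zero, Pi.zero_apply]
  by_contra hW
  obtain ⟨z, hz⟩ := (T.hasPureDim_of_mult_ne_zero hW).nonempty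
  exact h (HolomorphicChain.subset_support hW hz)

/-- **THE CLASS OF A GENERAL ITERATED TRANSLATE INTERSECTION.** Let `Y ⊆ X` be a closed analytic subset of
pure dimension `d = r + k` (codimension `p`) of the compact complex torus `X`, `D₀, …, D_{k−1} ⊆ X` closed
analytic hypersurfaces, and suppose there is a closed analytic hypersurface `H ⊆ X` such that EVERY `r`
TRANSLATES OF `H` MEET EVERY IRREDUCIBLE `r`-DIMENSIONAL CLOSED ANALYTIC `W ⊆ Y` (numerical positivity
`[W] · [H]^r ≠ 0`; e.g. an ample divisor of an abelian variety). Then for almost every `τ = (t_j) ∈ X^k`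
(product Haar measure) the iterated translate intersection `Z(τ) = Y ∩ ⋂_j (D_j − t_j)` is empty or of pure
dimension `r`, and

  `sign(e)^k · [Y]_e ∧ [D₀]_e ∧ ⋯ ∧ [D_{k−1}]_e = [Z(τ)]_e`

in `H^{2(p+k)}(X, ℂ)` (`[∅] = 0`): the intersection class `Y · D₀ ⋯ D_{k−1}` is represented by the
set-theoretic intersection with general translates, ALL MULTIPLICITIES BEING ONE ([Lange2023AbelianVarietiesComplex,
§4.6.2: "`(V · W)` is the degree of `V · t_x^* W`"]; [Fulton1998, Example 11.4.5]: "the cycles `φ_g(V) · W`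
… represent `V · W`"; Kleiman's theorem (b)). Proof: by file 4, `sign^k · [Y] ∧ ⋯ = [Z(τ)] + cl(T_τ)` with
`T_τ ≥ 0` on `Z(τ)` for a.e. `τ`; counting the points of `Z(τ) ∩ ⋂_{i<r} (H − s_i)` for a.e. `(τ, s)`
(`ae_finite_inter_iInter_translate_and_wedge_wedgeFamily_eq` for `Y` and the `k + r` hypersurfaces `D_j, H`,
Fubini §1) and for a.e. `s` at fixed `τ` (the same theorem for `Z(τ)` and `r` copies of `H`) shows that the
`H`-degree `⟨· ∧ [H]^r⟩` of `cl(T_τ)` vanishes; but each component `W` of `T_τ` has positive `H`-degree (a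
general `W ∩ ⋂_i (H − s_i)` is finite and, by the hypothesis, non-empty), so `T_τ = 0`.
[cite: Lange2023AbelianVarietiesComplex, §4.6.2 Lemma 4.6.4 and p. 235; proof of Lemma 4.6.9]
[cite: Fulton1998, §8.2, Example 11.4.5 and Appendix B.9.2] [cite: Kleiman1974Transversality, Thm. 2] -/
theorem ae_smul_wedge_wedgeFamily_eq_setCycleClass {q : ℕ} (hq : 2 * q + 2 * 1 = n)
    (k : ℕ) {d p p' r : ℕ} (hk : 2 * d + 2 * p = n) (hp' : p + k = p') (hr : r + k = d)
    {Y : Set (ComplexTorus Φ)} (hY : HasPureDim 𝓘(ℂ, E) Y d)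
    {D : Fin k → Set (ComplexTorus Φ)} (hD : ∀ j, HasPureDim 𝓘(ℂ, E) (D j) q)
    {H : Set (ComplexTorus Φ)} (hH : HasPureDim 𝓘(ℂ, E) H q)
    (hpos : ∀ W ⊆ Y, IsIrreducibleAnalyticSet 𝓘(ℂ, E) W → HasPureDim 𝓘(ℂ, E) W r →
      ∀ s : Fin r → ComplexTorus Φ, (W ∩ ⋂ i, (fun x ↦ x + s i) ⁻¹' H).Nonempty) :
    ∀ᵐ τ ∂(volume : Measure (Fin k → ComplexTorus Φ)),
      (Y ∩ ⋂ j, (fun x ↦ x + τ j) ⁻¹' D j = ∅ ∨ HasPureDim 𝓘(ℂ, E) (Y ∩ ⋂ j, (fun x ↦ x + τ j) ⁻¹' D j) r) ∧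
        (orientationSign Φ e : ℂ) ^ k •
            ((analyticCycleClass Φ e hk hY).wedge
                (wedgeFamily k fun j ↦ analyticCycleClass Φ e hq (hD j))).domDomCongr
              (finCongr (by omega : 2 * p + 2 * k = 2 * p')) =
          setCycleClass Φ e (by omega : 2 * r + 2 * p' = n) (Y ∩ ⋂ j, (fun x ↦ x + τ j) ⁻¹' D j) := by
  classical
  have hng : finrank ℂ E * 2 = n := finrank_complex_mul_two Φ e
  have hq1 : q + 1 = finrank ℂ E := by omega
  have hd : d = k + r := by omega
  subst hd
  have h2 : 2 * r + 2 * p' = n := by omega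
  have hn : 2 * p' + 2 * r = n := by omega
  -- (1) the point count for `Y` and the `k + r` hypersurfaces `(D, H, …, H)`, for a.e. `u ∈ X^{k+r}`
  have hDH : ∀ j, HasPureDim 𝓘(ℂ, E) (Fin.append D (fun _ : Fin r ↦ H) j) q :=
    hasPureDim_append Φ hD (fun _ ↦ hH)
  have hJ := ae_finite_inter_iInter_translate_and_wedge_wedgeFamily_eq Φ e hq (k + r) hk hY hDH
  obtain ⟨u₀, -, hu₀⟩ := hJ.exists
  set N := (Y ∩ ⋂ j, (fun x ↦ x + u₀ j) ⁻¹' Fin.append D (fun _ : Fin r ↦ H) j).ncard with hNdef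
  -- the count is a.e. equal to `N`
  have hJ' : ∀ᵐ u ∂(volume : Measure (Fin (k + r) → ComplexTorus Φ)),
      (Y ∩ ⋂ j, (fun x ↦ x + u j) ⁻¹' Fin.append D (fun _ : Fin r ↦ H) j).Finite ∧
        (Y ∩ ⋂ j, (fun x ↦ x + u j) ⁻¹' Fin.append D (fun _ : Fin r ↦ H) j).ncard = N := by
    filter_upwards [hJ] with u ⟨hfin, hcl⟩
    refine ⟨hfin, ?_⟩
    rw [hu₀] at hcl
    have h := mul_left_cancel₀ (pow_orientationSign_ne_zero Φ e (k + r + 1)) (smul_volumeForm_injective Φ e hcl.symm)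
    exact_mod_cast h
  -- (2) Fubini: for a.e. `τ`, for a.e. `s`, `#(Z(τ) ∩ ⋂_i (H − s_i)) = N`
  have hprod := ae_ae_append_of_ae Φ hJ'
  -- (3) the properness of all sub-intersections, a.e. (file 4 §5)
  have hprop := ae_forall_inter_biInter_translate_eq_empty_or_hasPureDim Φ hq1 (by omega : k ≤ k + r) hY hD
  filter_upwards [hprop, hprod] with τ hτ hτN
  have hZ := hτ Finset.univ
  simp only [Finset.mem_univ, iInter_true, Finset.card_univ, Fintype.card_fin, Nat.add_sub_cancel_left] at hZ
  refine ⟨hZ, ?_⟩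
  -- file 4: `sign^k · [Y] ∧ ⋯ = [Z(τ)] + cl(T)`, `T ≥ 0` on `Z(τ)`; it remains to see `T = 0`
  obtain ⟨T, hT0, hTs, hTcl⟩ := exists_effectiveCycle_smul_wedge_wedgeFamily_eq_setCycleClass_add Φ e hq k hk
    hp' (by omega) hY hD τ hτ
  suffices hT : T = 0 by rw [hTcl, hT, chainCycleClass_zero, add_zero]
  rcases hZ with hZ0 | hZr
  · exact eq_zero_of_support_subset_empty Φ T (hZ0 ▸ hTs)
  by_contra hTne
  -- (4) `H`-degrees: of `[Z(τ)]` (the a.e. count for `Z(τ)` and `r` copies of `H`, equal to `N` by (2)) …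
  simp only [inter_iInter_translate_append] at hτN
  have hZJ := ae_finite_inter_iInter_translate_and_wedge_wedgeFamily_eq Φ e hq r h2 hZr (D := fun _ ↦ H)
    fun _ ↦ hH
  beta_reduce at hZJ
  obtain ⟨s₀, ⟨-, hs₀cl⟩, -, hs₀N⟩ := (hZJ.and hτN).exists
  rw [hs₀N] at hs₀cl
  -- … of the components `W` of `T` (positive, by the hypothesis) …
  set F := T.finite_components_of_compactSpace.toFinset with hF
  have hW : ∀ W ∈ F, ∃ m : ℕ, 1 ≤ m ∧
      ((setCycleClass Φ e h2 W).wedge (wedgeFamily r fun _ : Fin r ↦ analyticCycleClass Φ e hq hH)).domDomCongr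
          (finCongr hn) = (((orientationSign Φ e : ℤ) : ℂ) ^ (r + 1) * (m : ℂ)) • volumeForm Φ e := by
    intro W hWF
    have hW0 : T.mult W ≠ 0 := T.finite_components_of_compactSpace.mem_toFinset.1 hWF
    have hWd : HasPureDim 𝓘(ℂ, E) W r := T.hasPureDim_of_mult_ne_zero hW0
    have hWirr := T.isIrreducibleAnalyticSet_of_mult_ne_zero hW0
    have hWY : W ⊆ Y := ((HolomorphicChain.subset_support hW0).trans hTs).trans inter_subset_left
    obtain ⟨s, hfin, hcl⟩ := exists_finite_inter_iInter_translate_and_wedge_wedgeFamily_eq Φ e hq r h2 hWd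
      (D := fun _ ↦ H) fun _ ↦ hH
    refine ⟨(W ∩ ⋂ i, (fun x ↦ x + s i) ⁻¹' H).ncard, (Set.ncard_pos hfin).2 (hpos W hWY hWirr hWd s), ?_⟩
    rw [setCycleClass_of_hasPureDim Φ e h2 hWd, hcl]
  choose! m hm1 hmcl using hW
  -- … and of the intersection class (the count `N` of (1))
  have hcY : (((orientationSign Φ e : ℂ) ^ k •
      ((analyticCycleClass Φ e hk hY).wedge
          (wedgeFamily k fun j ↦ analyticCycleClass Φ e hq (hD j))).domDomCongr
        (finCongr (by omega : 2 * p + 2 * k = 2 * p'))).wedge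
        (wedgeFamily r fun _ : Fin r ↦ analyticCycleClass Φ e hq hH)).domDomCongr (finCongr hn) =
      (((orientationSign Φ e : ℤ) : ℂ) ^ (r + 1) * (N : ℂ)) • volumeForm Φ e := by
    rw [wedge_smul_left_complex, domDomCongr_finCongr_smul, wedge_wedgeFamily_append_eq Φ e hq hp' _ hD
      (fun _ ↦ hH) hDH hn, hu₀, smul_smul, ← mul_assoc, ← pow_add,
      show k + (k + r + 1) = 2 * k + (r + 1) by ring, pow_orientationSign_two_mul_add]
  -- (5) wedge the identity of file 4 with `[H]^r`: the `H`-degree of `cl(T)` is `0`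
  have hdeg := congrArg (fun x : E [⋀^Fin (2 * p')]→L[ℝ] ℂ ↦
    (x.wedge (wedgeFamily r fun _ : Fin r ↦ analyticCycleClass Φ e hq hH)).domDomCongr (finCongr hn)) hTcl
  rw [hcY, ContinuousAlternatingMap.wedge_add_left, ContinuousAlternatingMap.domDomCongr_add,
    setCycleClass_of_hasPureDim Φ e h2 hZr, hs₀cl,
    chainCycleClass_eq_sum_of_subset Φ e h2 T (S := F) fun Z hZ ↦ T.finite_components_of_compactSpace.mem_toFinset.2 hZ,
    sum_wedge_left, domDomCongr_sum, Finset.sum_congr rfl fun W hWF ↦ by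
      rw [show T.mult W • setCycleClass Φ e h2 W = ((T.mult W : ℤ) : ℂ) • setCycleClass Φ e h2 W from
          (Int.cast_smul_eq_zsmul ℂ _ _).symm, wedge_smul_left_complex, domDomCongr_finCongr_smul, hmcl W hWF,
        smul_smul],
    ← Finset.sum_smul, ← add_smul] at hdeg
  have hS := left_eq_add.1 (smul_volumeForm_injective Φ e hdeg)
  have hfac : ∑ W ∈ F, ((T.mult W : ℤ) : ℂ) * ((((orientationSign Φ e : ℤ) : ℂ) ^ (r + 1)) * (m W : ℂ)) =
      (((orientationSign Φ e : ℤ) : ℂ) ^ (r + 1)) * ∑ W ∈ F, ((T.mult W : ℤ) : ℂ) * (m W : ℂ) := by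
    rw [Finset.mul_sum]
    exact Finset.sum_congr rfl fun W _ ↦ by ring
  rw [hfac] at hS
  have hsum0 : ∑ W ∈ F, ((T.mult W : ℤ) : ℂ) * (m W : ℂ) = 0 :=
    (mul_eq_zero.1 hS).resolve_left (pow_orientationSign_ne_zero Φ e (r + 1))
  have hint : ∑ W ∈ F, T.mult W * (m W : ℤ) = 0 := by exact_mod_cast hsum0
  -- (6) but `T ≠ 0` has a component, of positive multiplicity and positive `H`-degree
  obtain ⟨W₀, hW₀⟩ : ∃ W, T.mult W ≠ 0 := by
    by_contra h
    push Not at h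
    exact hTne (HolomorphicChain.ext (funext fun W ↦ by rw [h W, HolomorphicChain.mult_zero, Pi.zero_apply]))
  have hFne : F.Nonempty := ⟨W₀, T.finite_components_of_compactSpace.mem_toFinset.2 hW₀⟩
  have hposum : 0 < ∑ W ∈ F, T.mult W * (m W : ℤ) :=
    Finset.sum_pos (fun W hWF ↦ mul_pos
      (lt_of_le_of_ne (hT0 W) (Ne.symm (T.finite_components_of_compactSpace.mem_toFinset.1 hWF)))
      (by exact_mod_cast hm1 W hWF)) hFne
  exact absurd hint hposum.ne'

/-- **Some iterated translate (indeed almost every one) realises the intersection class as the class of the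
set-theoretic intersection**, under the positivity hypothesis (P) on `H`.
[cite: Lange2023AbelianVarietiesComplex, §4.6.2 Lemma 4.6.4 and p. 235] [cite: Fulton1998, Example 11.4.5] -/
theorem exists_smul_wedge_wedgeFamily_eq_setCycleClass {q : ℕ} (hq : 2 * q + 2 * 1 = n)
    (k : ℕ) {d p p' r : ℕ} (hk : 2 * d + 2 * p = n) (hp' : p + k = p') (hr : r + k = d)
    {Y : Set (ComplexTorus Φ)} (hY : HasPureDim 𝓘(ℂ, E) Y d)
    {D : Fin k → Set (ComplexTorus Φ)} (hD : ∀ j, HasPureDim 𝓘(ℂ, E) (D j) q)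
    {H : Set (ComplexTorus Φ)} (hH : HasPureDim 𝓘(ℂ, E) H q)
    (hpos : ∀ W ⊆ Y, IsIrreducibleAnalyticSet 𝓘(ℂ, E) W → HasPureDim 𝓘(ℂ, E) W r →
      ∀ s : Fin r → ComplexTorus Φ, (W ∩ ⋂ i, (fun x ↦ x + s i) ⁻¹' H).Nonempty) :
    ∃ τ : Fin k → ComplexTorus Φ,
      (Y ∩ ⋂ j, (fun x ↦ x + τ j) ⁻¹' D j = ∅ ∨ HasPureDim 𝓘(ℂ, E) (Y ∩ ⋂ j, (fun x ↦ x + τ j) ⁻¹' D j) r) ∧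
        (orientationSign Φ e : ℂ) ^ k •
            ((analyticCycleClass Φ e hk hY).wedge
                (wedgeFamily k fun j ↦ analyticCycleClass Φ e hq (hD j))).domDomCongr
              (finCongr (by omega : 2 * p + 2 * k = 2 * p')) =
          setCycleClass Φ e (by omega : 2 * r + 2 * p' = n) (Y ∩ ⋂ j, (fun x ↦ x + τ j) ⁻¹' D j) :=
  (ae_smul_wedge_wedgeFamily_eq_setCycleClass Φ e hq k hk hp' hr hY hD hH hpos).exists

/-- The positivity hypothesis (P) in COHOMOLOGICAL form: it suffices that `[W]_e ∧ [H]_e^{∧r} ≠ 0` for every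
irreducible `r`-dimensional closed analytic `W ⊆ Y` (`wedge_wedgeFamily_ne_zero_iff_forall_inter_iInter_translate_nonempty`:
`[W] ∧ [H]^r ≠ 0` iff every `r` translates of `H` meet `W`). [cite: Lange2023AbelianVarietiesComplex, §4.6.2 Lemma 4.6.4 and p. 235]
[cite: Fulton1998, Example 11.4.5 and §12.2] [cite: Kleiman1974Transversality, Thm. 2] -/
theorem ae_smul_wedge_wedgeFamily_eq_setCycleClass_of_wedge_wedgePow_ne_zero {q : ℕ} (hq : 2 * q + 2 * 1 = n)
    (k : ℕ) {d p p' r : ℕ} (hk : 2 * d + 2 * p = n) (hp' : p + k = p') (hr : r + k = d)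
    {Y : Set (ComplexTorus Φ)} (hY : HasPureDim 𝓘(ℂ, E) Y d)
    {D : Fin k → Set (ComplexTorus Φ)} (hD : ∀ j, HasPureDim 𝓘(ℂ, E) (D j) q)
    {H : Set (ComplexTorus Φ)} (hH : HasPureDim 𝓘(ℂ, E) H q)
    (hpos : ∀ W ⊆ Y, IsIrreducibleAnalyticSet 𝓘(ℂ, E) W → (hW : HasPureDim 𝓘(ℂ, E) W r) →
      (analyticCycleClass Φ e (by omega : 2 * r + 2 * p' = n) hW).wedge
        (wedgePow (analyticCycleClass Φ e hq hH) r) ≠ 0) :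
    ∀ᵐ τ ∂(volume : Measure (Fin k → ComplexTorus Φ)),
      (Y ∩ ⋂ j, (fun x ↦ x + τ j) ⁻¹' D j = ∅ ∨ HasPureDim 𝓘(ℂ, E) (Y ∩ ⋂ j, (fun x ↦ x + τ j) ⁻¹' D j) r) ∧
        (orientationSign Φ e : ℂ) ^ k •
            ((analyticCycleClass Φ e hk hY).wedge
                (wedgeFamily k fun j ↦ analyticCycleClass Φ e hq (hD j))).domDomCongr
              (finCongr (by omega : 2 * p + 2 * k = 2 * p')) =
          setCycleClass Φ e (by omega : 2 * r + 2 * p' = n) (Y ∩ ⋂ j, (fun x ↦ x + τ j) ⁻¹' D j) :=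
  ae_smul_wedge_wedgeFamily_eq_setCycleClass Φ e hq k hk hp' hr hY hD hH fun W hWY hWirr hW ↦
    (wedge_wedgeFamily_ne_zero_iff_forall_inter_iInter_translate_nonempty Φ e hq r (by omega : 2 * r + 2 * p' = n)
      hW (D := fun _ ↦ H) fun _ ↦ hH).1 (hpos W hWY hWirr hW)

end ComplexTorus
end Literature.Geometry.Kaehler

end
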